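import Summits.BirchSwinnertonDyer.Rank1Residual.Additive.GordRankZeroChiBranch
import Literature.NumberTheory.EllipticCurves.QuadraticTwistMinimalModelProofs
import Literature.NumberTheory.EllipticCurves.QuadraticTwistIntegralModel
import Literature.NumberTheory.DiophantineGeometry.MinimalDiscriminantProofs
import Literature.NumberTheory.DiophantineGeometry.MinimalDiscriminantSmulProofs
import HarnessLib

/-!
# Good reduction away from `p` passes between an additive curve `W` and its twist model
# `C • V^{(p)} = W`, `p ≡ 1 (mod 4)` (route K1 `AdditiveBranchIMC`, crux ReadingFacts, child 19297
# `GreenbergVatsalResidualBranch` — supports only; seat `bsd-inputs-abimc-rf-p1`)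

HONEST FRAMING (cell `bsd-addord`, `run/shared/lean/pub/bsd-addord/README.md` §4): THEOREMS ONLY (no
`def`, no named fact, no `sorry`); nothing is booked; BSD is not proved by any of this. TOOL for the
kernel derivation of the reading fact `GreenbergVatsal2000.thm312_branch_…` (item 19297) from the
typed Thm. (3.11) at `χ = (·/p)` (`…GreenbergVatsalResidualBranchOfPrint.lean`): that statement wants
`V` of good reduction off `Σ₀ ∪ {p}`, the reading gives it for `W`.

## What

* `hasGoodReductionAt_of_smul_quadraticTwist_of_mod_four_eq_one` — for `p ≡ 1 (mod 4)`, a place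
  `v ∤ p` of `ℚ` and `C • W^{(p)} = V`: `W` good at `v` ⟹ `V` good at `v`. Proof: with `k = (p−1)/4 ∈ ℤ`
  the integral twist model `W.twistModel k` is a `ℚ`-model of `W^{(4k+1)} = W^{(p)}`
  (`exists_variableChange_twistModel_eq_quadraticTwist`) with the same `ord_v Δ_min` as `W` whenever
  `|k|_v ≤ 1`, `|4k+1|_v = 1` (`ordMinimalDiscriminant_twistModel`, Silverman VII.1.3 — this covers
  `v ∣ 2` as well, `ℚ(√p)/ℚ` being unramified at `2`), `ord_v Δ_min` is a `ℚ`-isomorphism invariant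
  (`ordMinimalDiscriminant_smul_holds`) and good reduction is `ord_v Δ_min = 0`
  (`ordMinimalDiscriminant_eq_zero_iff_holds`).
* `hasGoodReductionAt_of_quadraticTwist_smul_eq_of_mod_four_eq_one` — the same for the reading's
  orientation `C • V^{(p)} = W` (twist involution `exists_variableChange_twist_of_model_twist`), as the
  hypothesis `∀ v ∉ Σ₀, v ∤ p → V good at v` of `thm311_quadraticTwist_…`.

References: [SilvermanAEC2009] VII.1 Prop. 1.3, VII.5 Prop. 5.1(a), X.5 Cor. 5.4.
-/

set_option autoImplicit false
set_option linter.dupNamespace false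

noncomputable section

open scoped Classical

namespace Summit.BirchSwinnertonDyer.BirchSwinnertonDyer.Theorems.AdditiveBranchIMCGreenbergVatsalResidualBranchGoodReduction

open NumberField IsDedekindDomain WeierstrassCurve Literature.NumberTheory.EllipticCurves
  Literature.NumberTheory.DiophantineGeometry
  Summit.BirchSwinnertonDyer.Rank1Residual.Additive

variable {p : ℕ}

/-- **Good reduction at `v ∤ p` passes from `W` to a model `V` of `W^{(p)}`, `p ≡ 1 (mod 4)`** (the
twist is unramified at every `v ∤ p`, including `v ∣ 2`; Silverman VII.1.3 via the integral twist model
`y² + a₁xy + a₃y = x³ + (a₂ + k a₁²)x² + …`, `4k + 1 = p`). [cite: SilvermanAEC2009, VII.1 Prop. 1.3 and VII.5 Prop. 5.1(a)] -/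
theorem hasGoodReductionAt_of_smul_quadraticTwist_of_mod_four_eq_one
    (W V : WeierstrassCurve ℚ) [W.IsElliptic] [V.IsElliptic] (hp4 : p % 4 = 1)
    {C : VariableChange ℚ} (hC : C • W.quadraticTwist (p : ℚ) = V)
    (v : HeightOneSpectrum (𝓞 ℚ)) (hpv : ((p : ℕ) : 𝓞 ℚ) ∉ v.asIdeal)
    (hW : W.HasGoodReductionAt v) : V.HasGoodReductionAt v := by
  -- the twisting parameter `k = (p−1)/4 ∈ ℕ`, `4k + 1 = p`
  set k : ℚ := ((p / 4 : ℕ) : ℚ) with hk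
  have hk4 : 4 * k + 1 = (p : ℚ) := by
    rw [hk]
    have h : 4 * (p / 4) + 1 = p := by omega
    exact_mod_cast h
  have hvk : v.valuation ℚ k ≤ 1 := by
    rw [hk, show (((p / 4 : ℕ) : ℚ)) = algebraMap (𝓞 ℚ) ℚ ((p / 4 : ℕ) : 𝓞 ℚ) by
      rw [map_natCast]]
    exact HeightOneSpectrum.valuation_le_one v _
  have hvd : v.valuation ℚ (4 * k + 1) = 1 := by
    rw [hk4, show ((p : ℚ)) = algebraMap (𝓞 ℚ) ℚ ((p : ℕ) : 𝓞 ℚ) by rw [map_natCast],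
      HeightOneSpectrum.valuation_of_algebraMap]
    exact le_antisymm (HeightOneSpectrum.intValuation_le_one v _)
      (not_lt.mp fun h ↦ hpv ((HeightOneSpectrum.intValuation_lt_one_iff_mem v _).mp h))
  -- the integral twist model is a `ℚ`-model of `W^{(p)}`, hence `ℚ`-isomorphic to `V`
  obtain ⟨C', -, hC'⟩ := W.exists_variableChange_twistModel_eq_quadraticTwist k
  rw [hk4] at hC'
  have hV : V = (C * C') • W.twistModel k := by rw [mul_smul, hC', hC]
  have hord : V.ordMinimalDiscriminant v = W.ordMinimalDiscriminant v := by
    rw [hV, ordMinimalDiscriminant_smul_holds v (W.twistModel k) (C * C'),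
      ordMinimalDiscriminant_twistModel v W hvk hvd]
  have h0 : W.ordMinimalDiscriminant v = 0 := (ordMinimalDiscriminant_eq_zero_iff_holds v W).mpr hW
  exact (ordMinimalDiscriminant_eq_zero_iff_holds v V).mp (by rw [hord, h0])

/-- **The `V`-side good-reduction hypothesis of `thm311_quadraticTwist_…` from the `W`-side one of the
reading** (`C • V^{(p)} = W`, `p ≡ 1 (mod 4)`; twist involution + the previous theorem).
[cite: SilvermanAEC2009, VII.5 Prop. 5.1(a) and X.5 Cor. 5.4] -/
theorem hasGoodReductionAt_of_quadraticTwist_smul_eq_of_mod_four_eq_one [hp : Fact p.Prime]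
    (V W : WeierstrassCurve ℚ) [V.IsElliptic] [W.IsElliptic] (hp4 : p % 4 = 1)
    {C : VariableChange ℚ} (hC : C • V.quadraticTwist (p : ℚ) = W)
    {S₀ : Finset (HeightOneSpectrum (𝓞 ℚ))}
    (hS : ∀ v : HeightOneSpectrum (𝓞 ℚ), v ∉ S₀ → ((p : ℕ) : 𝓞 ℚ) ∉ v.asIdeal →
      W.HasGoodReductionAt v) :
    ∀ v : HeightOneSpectrum (𝓞 ℚ), v ∉ S₀ → ((p : ℕ) : 𝓞 ℚ) ∉ v.asIdeal →
      V.HasGoodReductionAt v := by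
  intro v hv hpv
  have hp0 : (p : ℚ) ≠ 0 := by exact_mod_cast hp.out.ne_zero
  obtain ⟨C', hC'⟩ := exists_variableChange_twist_of_model_twist V hp0 hC
  exact hasGoodReductionAt_of_smul_quadraticTwist_of_mod_four_eq_one W V hp4 hC' v hpv (hS v hv hpv)

end Summit.BirchSwinnertonDyer.BirchSwinnertonDyer.Theorems.AdditiveBranchIMCGreenbergVatsalResidualBranchGoodReduction

end
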